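import Mathlib
import Summits.CriticalPhenomena.CardyFormulaZ2.Theorems.CardyWhiteToColouredDriftBoundPlackettStein
import Summits.CriticalPhenomena.CardyFormulaZ2.Theorems.CardyWhiteToColouredDriftBoundPlackettEnvelope

/-!
# Plackett/Piterbarg drift identity for the noise heat flow, part 3: differentiation under the
# Gaussian integral

Helper file for crux item `DriftBound` (stmt-CriticalPhenomena-4596) of route `CardyWhiteToColoured`
(`CardyFormulaZ2`), line `registered` (`Cruxes/DriftBound/Lines/birth.lean`, lead c3), sub-goal
`pl_hasDerivAt_integral_linGauss` of the exact drift identity: differentiation under the Gaussian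
integral.

Setting: `I` finite, `ι` countable, `γ∞ = ⨂_e N(0,1)` (Mathlib `Measure.infinitePi`) on `ι → ℝ`,
`Φ ∈ C¹_b(ℝ^I)`, and a one-parameter family of `ℓ¹`-linear Gaussian series
`X^σ_i(ξ) = ∑' e, G σ i e ξ_e` whose coefficients and `σ`-derivatives `G' σ i e` are dominated, for
`σ` in an open interval `(a, b)`, by one summable envelope `u`: `|G σ i e|, |G' σ i e| ≤ u e`. Then
`σ ↦ E[Φ(X^σ)]` is differentiable on `(a, b)` with derivative `E[DΦ(X^σ)[Ẋ^σ]]`, where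
`Ẋ^σ_i(ξ) = ∑' e, G' σ i e ξ_e`:

* termwise differentiation of the series for a.e. `ξ` (those with `∑_e |u_e| |ξ_e| < ∞`,
  `pl_ae_summable_envelope`), Mathlib `hasDerivAt_tsum_of_isPreconnected`, then the chain rule;
* differentiation under `∫ dγ∞` by domination (`hasDerivAt_integral_of_dominated_loc_of_deriv_le`)
  with the integrable bound `M ∑' e, |u_e| |ξ_e|` (`pl_integrable_envelope`), `M` bounding `‖DΦ‖`.

References: D. Beliaev, S. Muirhead, A. Rivera, Ann. Probab. 48 (2020), Lemma 2.22 (Piterbarg's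
formula; this file is its differentiation-under-the-integral step); S. Muirhead, H. Vanneuville,
Ann. Inst. H. Poincaré Probab. Stat. 56 (2020), §2.1 (discretised white noise).
-/

noncomputable section

namespace Summit.CriticalPhenomena.CardyFormulaZ2.Cruxes.DriftBound.Birth

open MeasureTheory ProbabilityTheory Filter Topology Set
open scoped ENNReal NNReal

variable {ι : Type*} {I : Type*} [Fintype I]

/-- One coordinate of a dominated linear series against a noise with finite envelope is summable
and bounded by the envelope: `|∑' e, c_e ξ_e| ≤ ∑' e, v_e |ξ_e|` when `|c_e| ≤ v_e`. -/
theorem pd_norm_tsum_le {c v ξ : ι → ℝ} (hc : ∀ e, |c e| ≤ v e)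
    (hξ : Summable fun e => v e * |ξ e|) :
    (Summable fun e => c e * ξ e) ∧ ‖∑' e, c e * ξ e‖ ≤ ∑' e, v e * |ξ e| := by
  have hle : ∀ e, ‖c e * ξ e‖ ≤ v e * |ξ e| := fun e => by
    rw [Real.norm_eq_abs, abs_mul]
    exact mul_le_mul_of_nonneg_right (hc e) (abs_nonneg _)
  exact ⟨hξ.of_norm_bounded hle, tsum_of_norm_bounded hξ.hasSum hle⟩

/-- The sup norm of a vector of dominated linear series is bounded by the envelope. -/
theorem pd_pi_norm_tsum_le {c : I → ι → ℝ} {v ξ : ι → ℝ} (hv : ∀ e, 0 ≤ v e)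
    (hc : ∀ i e, |c i e| ≤ v e) (hξ : Summable fun e => v e * |ξ e|) :
    ‖(fun i : I => ∑' e, c i e * ξ e)‖ ≤ ∑' e, v e * |ξ e| :=
  (pi_norm_le_iff_of_nonneg (tsum_nonneg fun e => mul_nonneg (hv e) (abs_nonneg _))).2
    fun i => (pd_norm_tsum_le (hc i) hξ).2

/-- **Termwise differentiation of a dominated linear Gaussian series** at a noise with finite
envelope: if `|g σ e|, |g' σ e| ≤ v e` on `(a, b)` with `g' σ e` the `σ`-derivative of `g σ e`, and
`∑_e v_e |ξ_e| < ∞`, then `σ ↦ ∑' e, g σ e ξ_e` has derivative `∑' e, g' σ e ξ_e` on `(a, b)`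
(Mathlib `hasDerivAt_tsum_of_isPreconnected` on the interval). -/
theorem pd_hasDerivAt_tsum {a b : ℝ} {g g' : ℝ → ι → ℝ} {v ξ : ι → ℝ}
    (hg : ∀ σ ∈ Ioo a b, ∀ e, HasDerivAt (fun s => g s e) (g' σ e) σ)
    (hgv : ∀ σ ∈ Ioo a b, ∀ e, |g σ e| ≤ v e) (hg'v : ∀ σ ∈ Ioo a b, ∀ e, |g' σ e| ≤ v e)
    (hξ : Summable fun e => v e * |ξ e|) {σ : ℝ} (hσ : σ ∈ Ioo a b) :
    HasDerivAt (fun s => ∑' e, g s e * ξ e) (∑' e, g' σ e * ξ e) σ := by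
  have hle : ∀ e, ∀ s ∈ Ioo a b, ‖g' s e * ξ e‖ ≤ v e * |ξ e| := fun e s hs => by
    rw [Real.norm_eq_abs, abs_mul]
    exact mul_le_mul_of_nonneg_right (hg'v s hs e) (abs_nonneg _)
  exact hasDerivAt_tsum_of_isPreconnected (g := fun e s => g s e * ξ e)
    (g' := fun e s => g' s e * ξ e) hξ isOpen_Ioo isPreconnected_Ioo
    (fun e s hs => (hg s hs e).mul_const (ξ e)) hle hσ (pd_norm_tsum_le (hgv σ hσ) hξ).1 hσ

/-- **Chain rule for the field**: for a noise `ξ` with finite envelope and `Φ` differentiable,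
`σ ↦ Φ(X^σ ξ)` has derivative `DΦ(X^σ ξ)[Ẋ^σ ξ]` on `(a, b)`, where `X^σ_i ξ = ∑' e, G σ i e ξ_e`
and `Ẋ^σ_i ξ = ∑' e, G' σ i e ξ_e`. -/
theorem pd_hasDerivAt_comp {a b : ℝ} {G G' : ℝ → I → ι → ℝ} {v ξ : ι → ℝ}
    (hG : ∀ σ ∈ Ioo a b, ∀ i e, HasDerivAt (fun s => G s i e) (G' σ i e) σ)
    (hGv : ∀ σ ∈ Ioo a b, ∀ i e, |G σ i e| ≤ v e) (hG'v : ∀ σ ∈ Ioo a b, ∀ i e, |G' σ i e| ≤ v e)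
    (hξ : Summable fun e => v e * |ξ e|) {Φ : (I → ℝ) → ℝ} (hΦ : Differentiable ℝ Φ)
    {σ : ℝ} (hσ : σ ∈ Ioo a b) :
    HasDerivAt (fun s => Φ (fun i => ∑' e, G s i e * ξ e))
      (fderiv ℝ Φ (fun i => ∑' e, G σ i e * ξ e) (fun i => ∑' e, G' σ i e * ξ e)) σ := by
  have hX : HasDerivAt (fun s => fun i => ∑' e, G s i e * ξ e) (fun i => ∑' e, G' σ i e * ξ e) σ :=
    hasDerivAt_pi.2 fun i => pd_hasDerivAt_tsum (fun s hs e => hG s hs i e)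
      (fun s hs e => hGv s hs i e) (fun s hs e => hG'v s hs i e) hξ hσ
  exact (hΦ _).hasFDerivAt.comp_hasDerivAt σ hX

variable [Countable ι]

omit [Fintype I] in
/-- The vector of linear series `ξ ↦ (∑' e, c i e ξ_e)_i` is measurable in the noise. -/
theorem pd_measurable_linSeries (c : I → ι → ℝ) :
    Measurable fun ξ : ι → ℝ => fun i : I => ∑' e, c i e * ξ e :=
  measurable_pi_lambda _ fun _ => Measurable.tsum fun e => measurable_const.mul (measurable_pi_apply e)

/-- **Differentiation under the Gaussian integral (registered form).** For `Φ ∈ C¹_b(ℝ^I)` (`I`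
finite), a countable family of i.i.d. standard Gaussians `ξ_e` (`γ∞ = Measure.infinitePi`), and
`ℓ¹`-linear series `X^σ_i = ∑' e, G σ i e ξ_e` whose coefficients and `σ`-derivatives are dominated
on `(a, b) ∋ σ₀` by a summable envelope `u`,
`d/dσ|_{σ₀} ∫ Φ(X^σ ξ) dγ∞(ξ) = ∫ DΦ(X^{σ₀} ξ)[Ẋ^{σ₀} ξ] dγ∞(ξ)` with `Ẋ^σ_i = ∑' e, G' σ i e ξ_e`
(Beliaev–Muirhead–Rivera 2020, Lemma 2.22, differentiation step). Proof: replace `u` by `|u| ≥ 0`;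
off a `γ∞`-null set `∑_e |u_e| |ξ_e| < ∞` (`pl_ae_summable_envelope`), where the integrand is
differentiable in `σ` (`pd_hasDerivAt_comp`) with derivative bounded by `M ∑' e, |u_e| |ξ_e|`
(integrable, `pl_integrable_envelope`); conclude by
`hasDerivAt_integral_of_dominated_loc_of_deriv_le`. -/
theorem pl_hasDerivAt_integral_linGauss : ∀ {ι : Type} [Countable ι] {I : Type} [Fintype I] (a b σ₀ : ℝ), σ₀ ∈ Set.Ioo a b → ∀ (G G' : ℝ → I → ι → ℝ) (u : ι → ℝ), Summable u → (∀ σ ∈ Set.Ioo a b, ∀ (i : I) (e : ι), HasDerivAt (fun s : ℝ => G s i e) (G' σ i e) σ) → (∀ σ ∈ Set.Ioo a b, ∀ (i : I) (e : ι), |G σ i e| ≤ u e) → (∀ σ ∈ Set.Ioo a b, ∀ (i : I) (e : ι), |G' σ i e| ≤ u e) → ∀ (Φ : (I → ℝ) → ℝ) (M : ℝ), ContDiff ℝ 1 Φ → (∀ x : I → ℝ, |Φ x| ≤ M) → (∀ x : I → ℝ, ‖fderiv ℝ Φ x‖ ≤ M) → HasDerivAt (fun σ : ℝ => MeasureTheory.integral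 (MeasureTheory.Measure.infinitePi (fun _ : ι => ProbabilityTheory.gaussianReal 0 1)) (fun ξ : ι → ℝ => Φ (fun i : I => ∑' e : ι, G σ i e * ξ e))) (MeasureTheory.integral (MeasureTheory.Measure.infinitePi (fun _ : ι => ProbabilityTheory.gaussianReal 0 1)) (fun ξ : ι → ℝ => fderiv ℝ Φ (fun i : I => ∑' e : ι, G σ₀ i e * ξ e) (fun i : I => ∑' e : ι, G' σ₀ i e * ξ e))) σ₀ := by
  intro ι _ I _ a b σ₀ hσ₀ G G' u hu hG hGu hG'u Φ M hΦ hΦM hΦ'M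
  -- the nonnegative envelope `v = |u|`
  have hv0 : ∀ e, 0 ≤ |u e| := fun e => abs_nonneg _
  have hvs : Summable fun e => |u e| := hu.abs
  have hGv : ∀ σ ∈ Ioo a b, ∀ i e, |G σ i e| ≤ |u e| := fun σ hσ i e =>
    (hGu σ hσ i e).trans (le_abs_self _)
  have hG'v : ∀ σ ∈ Ioo a b, ∀ i e, |G' σ i e| ≤ |u e| := fun σ hσ i e =>
    (hG'u σ hσ i e).trans (le_abs_self _)
  have hM0 : 0 ≤ M := (norm_nonneg _).trans (hΦ'M 0)
  have hΦd : Differentiable ℝ Φ := hΦ.differentiable one_ne_zero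
  have hΦc : Continuous Φ := hΦ.continuous
  have hΦ'c : Continuous (fderiv ℝ Φ) := hΦ.continuous_fderiv one_ne_zero
  have hev : Continuous fun p : (I → ℝ) × (I → ℝ) => fderiv ℝ Φ p.1 p.2 :=
    (hΦ'c.comp continuous_fst).clm_apply continuous_snd
  -- measurability of `X^σ` and `Ẋ^σ`
  have hXm : ∀ σ, Measurable fun ξ : ι → ℝ => fun i : I => ∑' e, G σ i e * ξ e := fun σ =>
    pd_measurable_linSeries (G σ)
  have hX'm : ∀ σ, Measurable fun ξ : ι → ℝ => fun i : I => ∑' e, G' σ i e * ξ e := fun σ =>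
    pd_measurable_linSeries (G' σ)
  refine (hasDerivAt_integral_of_dominated_loc_of_deriv_le
    (μ := Measure.infinitePi fun _ : ι => gaussianReal 0 1)
    (F := fun σ ξ => Φ (fun i => ∑' e, G σ i e * ξ e))
    (F' := fun σ ξ => fderiv ℝ Φ (fun i => ∑' e, G σ i e * ξ e) (fun i => ∑' e, G' σ i e * ξ e))
    (bound := fun ξ => M * ∑' e, |u e| * |ξ e|)
    (Ioo_mem_nhds hσ₀.1 hσ₀.2) ?_ ?_ ?_ ?_ ?_ ?_).2
  · exact Eventually.of_forall fun σ => (hΦc.measurable.comp (hXm σ)).aestronglyMeasurable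
  · exact pl_integrable_of_bounded_infinitePi (hΦc.measurable.comp (hXm σ₀)) fun ξ => hΦM _
  · exact (hev.measurable.comp ((hXm σ₀).prodMk (hX'm σ₀))).aestronglyMeasurable
  · filter_upwards [pl_ae_summable_envelope hvs hv0] with ξ hξ
    intro σ hσ
    calc ‖fderiv ℝ Φ (fun i => ∑' e, G σ i e * ξ e) (fun i => ∑' e, G' σ i e * ξ e)‖
        ≤ M * ‖(fun i : I => ∑' e, G' σ i e * ξ e)‖ := (fderiv ℝ Φ _).le_of_opNorm_le (hΦ'M _) _
      _ ≤ M * ∑' e, |u e| * |ξ e| :=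
          mul_le_mul_of_nonneg_left (pd_pi_norm_tsum_le hv0 (hG'v σ hσ) hξ) hM0
  · exact (pl_integrable_envelope hvs hv0).const_mul M
  · filter_upwards [pl_ae_summable_envelope hvs hv0] with ξ hξ
    intro σ hσ
    exact pd_hasDerivAt_comp hG hGv hG'v hξ hΦd hσ

end Summit.CriticalPhenomena.CardyFormulaZ2.Cruxes.DriftBound.Birth

end
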